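import Summits.NavierStokesRegularity.NavierStokesRegularity.Theorems.ArgmaxDoorsThreshold
import Summits.NavierStokesRegularity.NavierStokesRegularity.Theorems.ArgmaxDoorsDepletionLocal
import HarnessLib

/-!
# ArgmaxNearDoorsDefs — door family S36 §A «ArgmaxNearDoors» (nsreg-p1 g30, ROUND-34): texts of record
# (plate P0-36A, part 1 of 2: §0–§3 = the definitions; statement-only file)

LANDING NOTE: `HOME/ns-regularity-ideate-p1/r34/Sketch36A.lean` sha16 3ebc53b38700dd90 (texts of record, STATUS
2026-08-28T16:59:19Z) landed VERBATIM by LEAD S-door ns-s30-p1 g3, split in two ONLY because the gate caps Theorems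
files with proofs at 400 lines: this file = §0–§3 (every `def`, byte-identical); `ArgmaxNearDoorsCompositions.lean`
= §4–§6 (the proved support and the kernel-checked compositions, byte-identical). `--supports
stmt-NavierStokesRegularity-0056 --as helper`.

## The sketch header (verbatim)

The far field of the stretching rate at a vorticity argmax is PAID BY LERAY'S ENERGY INEQUALITY
(LEAD ns-s30-p1 g3, 16:11:15Z; tools `ArgmaxDoorsNearEngine` E♭/N♭, ns-sfl-p1 g5 `ArgmaxDoorsDepletionLocal` D♭):
with the local depletion split `⟪ω,(∇u)ω⟫(x̄) ≤ |ω(x̄)|²·(A·∫_{B(x̄,ρ)} |ω_⊥| |x̄−y|⁻³ + 8A'(4π/(3(ρ/2)³))^{1/2}‖ω(t)‖₂)`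
and `∫‖ω(t)‖₂ dt ≤ √(T−t₁)·√(C‖u(0)‖²₂/ν)` on every end slab, door S35-C's ONE-POINT hypothesis loses its
far field: only the NEAR-FIELD depletion integral around the argmax is charged.

* door S36-C♭ «ArgmaxNearCoherenceDoor» (fixed scale `R = r₀ > 0`, charged ball `B(x̄, 2R)` — the ball of
  D♭ `inner_stretching_le_local`): at every late CRITICAL argmax (`ε < (T−t)|ω(x̄,t)|`),
  `(T − t)·(A·∫_{B(x̄,2r₀)} |ω(y) − ⟪ω(y),ξ(x̄)⟫ξ(x̄)| |x̄−y|⁻³ dy − ν|∇ξ(x̄)|²_F) ≤ a` (`a < 1`) ⇒ continuation.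
  CLOSES from D♭ (landed, by name) + E♭ + N♭ + F (composition below, kernel-checked).
* door S36-C♯ «ArgmaxShrinkingCoherenceDoor» (scale `R = r₀(T−t)^β`, ball `B(x̄, 2R)`, `0 < β < 1/3` — the
  honest energy-class exponent: `∫^T (T−t)^{−3β} dt < ∞`): the same with the ball shrinking; plates E♭w (weighted
  engine) + N♭β (shrinking budget) — LEAD's `ArgmaxDoorsNearEngineWeighted`; composition kernel-checked.
* support `hasSobolevExtensionPast_of_barrier_family`: the common real-variable end of both doors.

HONEST LABEL: bookkeeping (variant / new-combination): CF93's depletion seen from ONE point (door S35-C) with the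
far field removed by Cauchy–Schwarz + the energy inequality; near-field print = Constantin–Fefferman 1993 (Lipschitz
coherence on the intense region), Grujić 2009 (localisation in a ball of fixed radius), Grujić–Ruzmaikina 2004.
WHAT THIS IS NOT: regularity CRITERIA about hypothetical blow-up; item 0056 `NoTypeII` / NS regularity NOT proved;
no Literature fact is a hypothesis; nothing here is a route or a summit statement (`--supports 0056 --as helper`).
-/

noncomputable section

open MeasureTheory Set Function Filter Metric Real InnerProductSpace
open _root_.Topology
open scoped ENNReal NNReal RealInnerProductSpace ContDiff
open Literature.Analysis Literature.Analysis.FluidPDE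
open Literature.Analysis.FluidPDE.VorticityDirectionDynamics

set_option linter.dupNamespace false

namespace Summit.NavierStokesRegularity.NavierStokesRegularity.Theorems.ArgmaxDoors

-- nested operator types (second derivatives)
set_option maxSynthPendingDepth 3

/-! ## §0 The near-field quantity -/

/-- support (definition): the NEAR-FIELD DEPLETION INTEGRAL seen from `x` at time `t`, radius `r`:
`∫_{B(x,r)} |ω(y) − ⟪ω(y), ξ(x)⟫ξ(x)| · |x − y|⁻³ dy` (`ξ(x) = vorticityDirection (curl (u t)) x`; the ball part of
P0's `depletionIntegral`). -/
def nearDepletionIntegral (u : ℝ → (EuclideanSpace ℝ (Fin 3)) → (EuclideanSpace ℝ (Fin 3))) (t : ℝ)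
    (x : EuclideanSpace ℝ (Fin 3)) (r : ℝ) : ℝ :=
  ∫ y in ball x r, ‖curl (u t) y - ⟪curl (u t) y, vorticityDirection (curl (u t)) x⟫ •
      vorticityDirection (curl (u t)) x‖ * (‖x - y‖ ^ 3)⁻¹

/-! ## §1 Door S36-C♭ «ArgmaxNearCoherenceDoor» (fixed radius) -/

/-- door S36-C♭ «ArgmaxNearCoherenceDoor» (regularity criterion; Constantin–Fefferman at ONE point, NEAR FIELD
ONLY). There is a universal `A ≥ 0` such that: `ν > 0`, `0 ≤ t₀ < T`, `a < 1`, `0 < ε < √3/4`, `r₀ > 0`, `(u,p)` in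
the frame; if at every late vorticity argmax `x̄` in the regime `(T − t)|ω(x̄,t)| > ε` the NEAR-FIELD depleted rate is
`a`-subcritical — `(T − t)·(A·∫_{B(x̄,2r₀)} |ω(y) − ⟪ω(y),ξ(x̄)⟫ξ(x̄)| |x̄−y|⁻³ dy − ν|∇ξ(x̄)|²_F) ≤ a` — then `u`
continues past `T`. The far field `|x̄ − y| ≥ 2r₀` is NOT charged: it is paid by the energy inequality (radius
convention = D♭'s `ball x (2 * R)`). -/
def ArgmaxNearCoherenceDoor : Prop :=
  ∃ A : ℝ, 0 ≤ A ∧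
  ∀ (ν T t₀ a ε r₀ : ℝ), 0 < ν → 0 ≤ t₀ → t₀ < T → a < 1 → 0 < ε → ε < Real.sqrt 3 / 4 → 0 < r₀ →
    ∀ (u : ℝ → (EuclideanSpace ℝ (Fin 3)) → (EuclideanSpace ℝ (Fin 3)))
      (p : ℝ → (EuclideanSpace ℝ (Fin 3)) → ℝ),
      IsClassicalNSSolutionOn (Ico 0 T) ν 0 u p →
      (∀ T'' < T, HasBoundedSobolevNormsOn (Icc 0 T'') u) →
      (∀ t ∈ Ico t₀ T, ∀ x, IsVorticityArgmax u t x → ε < (T - t) * ‖curl (u t) x‖ →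
        (T - t) * (A * nearDepletionIntegral u t x (2 * r₀) -
          ν * frobeniusNormSq (fderiv ℝ (vorticityDirection (curl (u t))) x)) ≤ a) →
      HasSobolevExtensionPast ν u T

/-! ## §2 Door S36-C♯ «ArgmaxShrinkingCoherenceDoor» (scale `R = r₀(T−t)^β`, ball `B(x̄,2R)`, `0 < β < 1/3`) -/

/-- door S36-C♯ «ArgmaxShrinkingCoherenceDoor» (regularity criterion; as C♭ with the charged ball SHRINKING like
`2r₀(T − t)^β`, `0 < β < 1/3`). There is a universal `A ≥ 0` such that in the frame (`ν > 0`, `0 ≤ t₀ < T`,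
`a < 1`, `0 < ε < √3/4`, `r₀ > 0`, `0 < β < 1/3`): if at every late critical argmax
`(T − t)·(A·∫_{B(x̄, 2r₀(T−t)^β)} |ω(y) − ⟪ω(y),ξ(x̄)⟫ξ(x̄)| |x̄−y|⁻³ dy − ν|∇ξ(x̄)|²_F) ≤ a`, then `u` continues
past `T`. (`β < 1/3` is exactly `∫^T (T−t)^{−3β} dt < ∞`: the far tail `(4π/(3R³))^{1/2}‖ω‖₂`, `R = r₀(T−t)^β`,
stays `L¹` in time against the energy class; `β = 1/2` — the parabolic ball — is NOT reachable this way.) -/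
def ArgmaxShrinkingCoherenceDoor : Prop :=
  ∃ A : ℝ, 0 ≤ A ∧
  ∀ (ν T t₀ a ε r₀ β : ℝ), 0 < ν → 0 ≤ t₀ → t₀ < T → a < 1 → 0 < ε → ε < Real.sqrt 3 / 4 → 0 < r₀ →
    0 < β → β < 1 / 3 →
    ∀ (u : ℝ → (EuclideanSpace ℝ (Fin 3)) → (EuclideanSpace ℝ (Fin 3)))
      (p : ℝ → (EuclideanSpace ℝ (Fin 3)) → ℝ),
      IsClassicalNSSolutionOn (Ico 0 T) ν 0 u p →
      (∀ T'' < T, HasBoundedSobolevNormsOn (Icc 0 T'') u) →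
      (∀ t ∈ Ico t₀ T, ∀ x, IsVorticityArgmax u t x → ε < (T - t) * ‖curl (u t) x‖ →
        (T - t) * (A * nearDepletionIntegral u t x (2 * (r₀ * (T - t) ^ β)) -
          ν * frobeniusNormSq (fderiv ℝ (vorticityDirection (curl (u t))) x)) ≤ a) →
      HasSobolevExtensionPast ν u T

/-! ## §3 Plates (solution-level statements; each provable in hours from LANDED tree tools) -/

/-- plate D♭ «LocalDepletion» (LANDED, BY NAME: ns-sfl-p1 g5 p649837 `ArgmaxDoors.inner_stretching_le_local`,
`Theorems/ArgmaxDoorsDepletionLocal.lean`; statement byte-identical — `localDepletion_holds` below). Universal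
`A, A' ≥ 0`: in the frame, at every
`t ∈ [0,T)` and `x` with `ω(x,t) ≠ 0`, for every `R > 0`: `‖ω(t)‖² ∈ L¹` and
`⟪ω,(∇u)ω⟫(x,t) ≤ |ω(x,t)|²·(A·∫_{B(x,2R)} |ω(y) − ⟪ω(y),ξ(x)⟫ξ(x)| |x−y|⁻³ dy + 8A'·(4π/(3R³))^{1/2}(∫‖ω(t)‖²)^{1/2})`. -/
def LocalDepletion : Prop :=
  ∃ A A' : ℝ, 0 ≤ A ∧ 0 ≤ A' ∧
    ∀ (ν T : ℝ) (u : ℝ → (EuclideanSpace ℝ (Fin 3)) → (EuclideanSpace ℝ (Fin 3)))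
      (p : ℝ → (EuclideanSpace ℝ (Fin 3)) → ℝ),
      IsClassicalNSSolutionOn (Ico 0 T) ν 0 u p →
      (∀ T'' < T, HasBoundedSobolevNormsOn (Icc 0 T'') u) →
      ∀ t ∈ Ico 0 T, ∀ x, curl (u t) x ≠ 0 → ∀ R : ℝ, 0 < R →
        Integrable (fun y => ‖curl (u t) y‖ ^ 2) ∧
        ⟪curl (u t) x, fderiv ℝ (u t) x (curl (u t) x)⟫ ≤ ‖curl (u t) x‖ ^ 2 *
          (A * (∫ y in ball x (2 * R), ‖curl (u t) y - ⟪curl (u t) y, vorticityDirection (curl (u t)) x⟫ •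
              vorticityDirection (curl (u t)) x‖ * (‖x - y‖ ^ 3)⁻¹) +
            8 * A' * ((4 * π / (3 * R ^ 3)) ^ (1 / (2 : ℝ)) * (∫ y, ‖curl (u t) y‖ ^ 2) ^ (1 / (2 : ℝ))))

/-- plate E♭ «NearEngine» (S; slab/frame form of LEAD ns-s30-p1 g3's
`ArgmaxDoors.norm_curl_le_barrier_exp_of_argmax_rate_le`, `Theorems/ArgmaxDoorsNearEngine.lean` — that theorem is
the case `t₁ = 0` on a closed slab with `‖ω(s)‖_{L²}` spelled `(eLpNorm (curl (v s)) 2 volume).toReal`; this plate is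
its time-translate with the enstrophy spelled `(∫‖ω(s)‖²)^{1/2}`). In the frame (`ν > 0`), on a slab
`[t₁,t₂] ⊂ [0,T)`, let `a ≤ 1`, `ε > 0`, `c, k ≥ 0`. If at every `s ∈ (t₁,t₂]` and every CRITICAL vorticity argmax
`x̄` (`ε < (T−s)|ω(s,x̄)|`) the twist-credited rate obeys `α − ν|∇ξ|²_F ≤ a/(T−s) + k‖ω(s)‖₂`, and
`|ω(t₁,·)| ≤ ε/(T−t₁) + c(T−t₁)^{−a}`, then `|ω(s,x)| ≤ (ε/(T−s) + c(T−s)^{−a})·exp(k∫_{t₁}^{s}‖ω(r)‖₂ dr)` on the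
slab (the supersolution `B₀e^{kΨ}`; threshold comparison). -/
def NearEngine : Prop :=
  ∀ (ν T : ℝ) (u : ℝ → (EuclideanSpace ℝ (Fin 3)) → (EuclideanSpace ℝ (Fin 3)))
    (p : ℝ → (EuclideanSpace ℝ (Fin 3)) → ℝ), 0 < ν →
    IsClassicalNSSolutionOn (Ico 0 T) ν 0 u p →
    (∀ T'' < T, HasBoundedSobolevNormsOn (Icc 0 T'') u) →
    ∀ (t₁ t₂ a ε c k : ℝ), 0 ≤ t₁ → t₁ ≤ t₂ → t₂ < T → a ≤ 1 → 0 < ε → 0 ≤ c → 0 ≤ k →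
      (∀ s ∈ Ioc t₁ t₂, ∀ x, IsVorticityArgmax u s x → ε < (T - s) * ‖curl (u s) x‖ →
        ⟪vorticityDirection (curl (u s)) x, fderiv ℝ (u s) x (vorticityDirection (curl (u s)) x)⟫ -
            ν * frobeniusNormSq (fderiv ℝ (vorticityDirection (curl (u s))) x) ≤
          a / (T - s) + k * (∫ y, ‖curl (u s) y‖ ^ 2) ^ (1 / (2 : ℝ))) →
      (∀ x, ‖curl (u t₁) x‖ ≤ ε / (T - t₁) + c * (T - t₁) ^ (-a)) →
      ∀ s ∈ Icc t₁ t₂, ∀ x, ‖curl (u s) x‖ ≤ (ε / (T - s) + c * (T - s) ^ (-a)) *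
        Real.exp (k * ∫ r in t₁..s, (∫ y, ‖curl (u r) y‖ ^ 2) ^ (1 / (2 : ℝ)))

/-- plate N♭ «SlabDissipationBudget» (S; slab form of LEAD's `ArgmaxDoors.exists_dissipation_budget` + Tao's energy
bound at the slab start, `tao_finite_energy_smooth_energy_bound_holds`). Universal `C ≥ 0`: in the frame, for
`0 ≤ t₁ ≤ t < T`, `∫_{t₁}^{t} ‖ω(s)‖₂ ds ≤ √(t − t₁)·√(C‖u(0)‖²₂/ν)` (`|ω|² ≤ κ²|∇u|²_F`,
`ν∫_{t₁}^{t}∫|∇u|²_F ≤ C_T‖u(t₁)‖²₂ ≤ C_T²‖u(0)‖²₂`, Cauchy–Schwarz in time). -/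
def SlabDissipationBudget : Prop :=
  ∃ C : ℝ, 0 ≤ C ∧
    ∀ (ν T : ℝ) (u : ℝ → (EuclideanSpace ℝ (Fin 3)) → (EuclideanSpace ℝ (Fin 3)))
      (p : ℝ → (EuclideanSpace ℝ (Fin 3)) → ℝ), 0 < ν →
      IsClassicalNSSolutionOn (Ico 0 T) ν 0 u p →
      (∀ T'' < T, HasBoundedSobolevNormsOn (Icc 0 T'') u) →
      ∀ (t₁ t : ℝ), 0 ≤ t₁ → t₁ ≤ t → t < T →
        ∫ s in t₁..t, (∫ y, ‖curl (u s) y‖ ^ 2) ^ (1 / (2 : ℝ)) ≤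
          Real.sqrt (t - t₁) * Real.sqrt (C * (∫ y, ‖u 0 y‖ ^ 2) / ν)

/-- plate E♭w «NearEngineWeighted» (S; slab/frame form of LEAD's `norm_curl_le_barrier_exp_of_argmax_rate_le_weighted`,
`Theorems/ArgmaxDoorsNearEngineWeighted.lean`: E♭ with a time-dependent far-field coefficient `k(s) ≥ 0` continuous on
the slab; the supersolution is `B₀·exp(∫_{t₁}^{s} k(r)‖ω(r)‖₂ dr)`; E♭ is the constant case). -/
def NearEngineWeighted : Prop :=
  ∀ (ν T : ℝ) (u : ℝ → (EuclideanSpace ℝ (Fin 3)) → (EuclideanSpace ℝ (Fin 3)))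
    (p : ℝ → (EuclideanSpace ℝ (Fin 3)) → ℝ), 0 < ν →
    IsClassicalNSSolutionOn (Ico 0 T) ν 0 u p →
    (∀ T'' < T, HasBoundedSobolevNormsOn (Icc 0 T'') u) →
    ∀ (t₁ t₂ a ε c : ℝ) (k : ℝ → ℝ), 0 ≤ t₁ → t₁ ≤ t₂ → t₂ < T → a ≤ 1 → 0 < ε → 0 ≤ c →
      ContinuousOn k (Icc t₁ t₂) → (∀ s ∈ Icc t₁ t₂, 0 ≤ k s) →
      (∀ s ∈ Ioc t₁ t₂, ∀ x, IsVorticityArgmax u s x → ε < (T - s) * ‖curl (u s) x‖ →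
        ⟪vorticityDirection (curl (u s)) x, fderiv ℝ (u s) x (vorticityDirection (curl (u s)) x)⟫ -
            ν * frobeniusNormSq (fderiv ℝ (vorticityDirection (curl (u s))) x) ≤
          a / (T - s) + k s * (∫ y, ‖curl (u s) y‖ ^ 2) ^ (1 / (2 : ℝ))) →
      (∀ x, ‖curl (u t₁) x‖ ≤ ε / (T - t₁) + c * (T - t₁) ^ (-a)) →
      ∀ s ∈ Icc t₁ t₂, ∀ x, ‖curl (u s) x‖ ≤ (ε / (T - s) + c * (T - s) ^ (-a)) *
        Real.exp (∫ r in t₁..s, k r * (∫ y, ‖curl (u r) y‖ ^ 2) ^ (1 / (2 : ℝ)))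

/-- plate N♭β «ShrinkingDissipationBudget» (S; LEAD's `exists_dissipation_budget_weighted`
(`Theorems/ArgmaxDoorsNearEngineWeighted.lean`: `∫₀ᵗ k‖ω‖₂ ≤ √(∫₀ᵗ k²)·√(C‖u(0)‖²₂/ν)`) time-translated to the slab
start, with `k(s)² = 4π/(3(r₀(T−s)^β)³)` and `∫_{t₁}^{t}(T−s)^{−3β}ds ≤ (T−t₁)^{1−3β}/(1−3β)` (`integral_rpow`):
`∫_{t₁}^{t} (4π/(3(r₀(T−s)^β)³))^{1/2} ‖ω(s)‖₂ ds ≤ (4π/(3r₀³))^{1/2}·((T−t₁)^{1−3β}/(1−3β))^{1/2}·√(C‖u(0)‖²₂/ν)`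
for `0 ≤ t₁ ≤ t < T`, `r₀ > 0`, `0 < β < 1/3`). -/
def ShrinkingDissipationBudget : Prop :=
  ∃ C : ℝ, 0 ≤ C ∧
    ∀ (ν T : ℝ) (u : ℝ → (EuclideanSpace ℝ (Fin 3)) → (EuclideanSpace ℝ (Fin 3)))
      (p : ℝ → (EuclideanSpace ℝ (Fin 3)) → ℝ), 0 < ν →
      IsClassicalNSSolutionOn (Ico 0 T) ν 0 u p →
      (∀ T'' < T, HasBoundedSobolevNormsOn (Icc 0 T'') u) →
      ∀ (t₁ t r₀ β : ℝ), 0 ≤ t₁ → t₁ ≤ t → t < T → 0 < r₀ → 0 < β → β < 1 / 3 →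
        ∫ s in t₁..t, (4 * π / (3 * (r₀ * (T - s) ^ β) ^ 3)) ^ (1 / (2 : ℝ)) *
            (∫ y, ‖curl (u s) y‖ ^ 2) ^ (1 / (2 : ℝ)) ≤
          (4 * π / (3 * r₀ ^ 3)) ^ (1 / (2 : ℝ)) * ((T - t₁) ^ (1 - 3 * β) / (1 - 3 * β)) ^ (1 / (2 : ℝ)) *
            Real.sqrt (C * (∫ y, ‖u 0 y‖ ^ 2) / ν)

end Summit.NavierStokesRegularity.NavierStokesRegularity.Theorems.ArgmaxDoors

end
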